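import Summits.ResolutionOfSingularities.ResolutionOfSingularities.Theorems.EquisingularLiftEquisingularLiftNatNDFrameLift
import Summits.ResolutionOfSingularities.ResolutionOfSingularities.Theorems.EquisingularLiftEquisingularLiftNatNDSncPointStep
import Summits.ResolutionOfSingularities.ResolutionOfSingularities.Theorems.EquisingularLiftEquisingularLiftNatNDSNCInv2
import Summits.ResolutionOfSingularities.ResolutionOfSingularities.Theorems.EquisingularLiftEquisingularLiftNatStrictTransformComap
import Summits.ResolutionOfSingularities.ResolutionOfSingularities.Theorems.EquisingularLiftEquisingularLiftNatCarrierDeltaFlat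
import Summits.ResolutionOfSingularities.ResolutionOfSingularities.Theorems.EquisingularLiftEquisingularLiftNatPrescribedGermDivisor
import Summits.ResolutionOfSingularities.ResolutionOfSingularities.Theorems.EquisingularLiftEquisingularLiftChainRegular
import Summits.ResolutionOfSingularities.ResolutionOfSingularities.Theorems.EquisingularLiftEquisingularLiftSectionKer
import Literature.AlgebraicGeometry.Resolution.BoundaryEquivalence
import Literature.AlgebraicGeometry.Resolution.MarkedIdealPointBlowup
import HarnessLib

/-!
# Crux EL♮(3) `EquisingularLiftNatThree` (stmt-ResolutionOfSingularities-20148), chain W4.5b — DEAL «ND-K5» brick (B3a),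
# part 3: `sncInv_init` — the candidate invariant `ND.SNCInv₂` holds after K5′'s point step

[OURS · L1 W4.5b · EL♮(3) stmt-ResolutionOfSingularities-20148 · (B3a) `sncInv_init` BY NAME against `ND.SNCInv₂` (SPEC v7/v8 §13.7 of
record) · res-type-027 g19 · helper, `--supports`; def-free; nothing of the manuscript under review [Hironaka2017] is asserted; AI-written,
weaker than expert review]

Construction: lift the frame `W` at `x` into `ker s♯` (`exists_frameLift`, part 1): `w̃₁, …, w̃ₙ`, `(ϖ, w̃)` an r.s.p. of `𝒪_{X',j x}`; the upstairs
models `W̃_i :=` the prime divisors with germ `(w̃_i)` (`exists_primeDivisorIdeal_stalkIdeal_eq_span`); `EX₁ := (frameBoundary W̃).stepAlong (ker s) 𝟙 τ₁`,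
`R := {𝟙} ∪ range e`. Clauses of `SNCInv₂`: (A1) base change of `Spec k ↪ Spec O`; (a) `strictTransformIdeal_top`; (b) `hsoff`; (c)+(c′) at the points of
`E = τ₁⁻¹(section)`: over `s(𝔪) = j x` from the r.s.p. `(ϖ, w̃)` and over `s(η)` from the r.s.p. `w̃` of `𝒪_{X',s(η)} = (𝒪_{X',j x})_{(w̃)}`
(`exists_rsop_genericSection`), both through the point step `sncWithAt_cons_comap_transform` (part 2), the fibre `j₂.ker = (j.ker)·𝒪_{X₁}`
(`ker_eq_comap_ker_of_isPullback`) being the TOTAL transform of the transversal member `V(ϖ)`; (d) the carrier identity for the ray `𝟙`, and for the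
frame rays F⁺5 `comap_strictTransformIdeal_eq_of_model` with the linear form `X_i` + `stalkIdeal_strictTransformIdeal_congr`.
-/

set_option linter.dupNamespace false -- mandated namespace `Summit.<Summit>.<Problem>` of this single-conjunct summit
set_option linter.overlappingInstances false -- signatures carry `[IsDomain O] [IsDiscreteValuationRing O]`

noncomputable section

open CategoryTheory CategoryTheory.Limits AlgebraicGeometry TopologicalSpace Topology IsLocalRing
open Literature.AlgebraicGeometry.Resolution
open AlgebraicGeometry.Scheme.IdealSheafData
open Summit.ResolutionOfSingularities.ResolutionOfSingularities.Cruxes.EquisingularLift.StrataSplit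
open Summit.ResolutionOfSingularities.ResolutionOfSingularities.Theorems (DepthSNC.SNCWithAt)

namespace Summit.ResolutionOfSingularities.ResolutionOfSingularities.Cruxes.EquisingularLiftNat.Sections.ND

/-! ## §1 Small print -/

/-- In a pullback square `(j, t; f, i)` with `i` a closed immersion, `ker j = (ker i)·𝒪` (`ker_fst_of_isClosedImmersion` along the comparison
isomorphism). [folklore] -/
theorem ker_eq_comap_ker_of_isPullback {F X S Z : Scheme.{0}} {j : F ⟶ X} {t : F ⟶ Z} {f : X ⟶ S} {i : Z ⟶ S} [IsClosedImmersion i]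
    (hsq : IsPullback j t f i) : j.ker = i.ker.comap f := by
  rw [← ker_fst_of_isClosedImmersion i f, ← hsq.isoPullback_hom_fst, Scheme.Hom.ker_comp_of_isIso]

/-- The points of `Spec` of a DVR: the closed point or the generic point `(0)`. [folklore] -/
theorem eq_closedPoint_or_asIdeal_eq_bot (O : Type) [CommRing O] [IsDomain O] [IsDiscreteValuationRing O] (z : Spec (.of O)) :
    z = IsLocalRing.closedPoint O ∨ z.asIdeal = ⊥ := by
  by_cases h : z.asIdeal = ⊥
  · exact Or.inr h
  · exact Or.inl (PrimeSpectrum.ext (IsLocalRing.eq_maximalIdeal (IsPrime.to_maximal_ideal (hpi := z.2) h)))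

/-- **The regular system of parameters at a generisation cut out by part of one.** With `𝒪_{X,p}` regular, r.s.p. `v = (v₀, …, vₙ)`, a centre `C` with
`C_p = (v₁, …, vₙ)`, members `W̃_i` with `(W̃_i)_p = (v_{i+1})` and `K₀` with `(K₀)_p = (v₀)`; at a generisation `p' ⤳ p` on `V(C)` where `v₀` is a unit
and such that the only prime `⊇ (v₁,…,vₙ)` missing `v₀` is `(v₁,…,vₙ)`: `𝒪_{X,p'}` (regular by hypothesis) has embedding dimension `n`, r.s.p. the images
`v'` of `v₁, …, vₙ`, `C_{p'} = (v')`, `(W̃_i)_{p'} = (v'_i)` and `K₀` misses `p'`. [cite: Matsumura1987, Thm. 14.2] -/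
theorem exists_rsop_genericSection {X : Scheme.{0}} {p : X} {n : ℕ} (hreg : IsRegularLocalRing (X.presheaf.stalk p))
    (v : Fin (n + 1) → X.presheaf.stalk p) (hsf : (maximalIdeal (X.presheaf.stalk p)).spanFinrank = n + 1)
    (hv : Ideal.span (Set.range v) = maximalIdeal (X.presheaf.stalk p))
    (K₀ : X.IdealSheafData) (hK₀ : stalkIdeal K₀ p = Ideal.span {v 0})
    (Wt : Fin n → X.IdealSheafData) (hWt : ∀ i, stalkIdeal (Wt i) p = Ideal.span {v i.succ})
    (C : X.IdealSheafData) (hC : stalkIdeal C p = Ideal.span (Set.range fun i : Fin n => v i.succ))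
    {p' : X} (h : p' ⤳ p) (hreg' : IsRegularLocalRing (X.presheaf.stalk p')) (hp'C : p' ∈ C.support)
    (hunit : IsUnit ((X.presheaf.stalkSpecializes h).hom (v 0)))
    (hquot : ∀ 𝔮 : Ideal (X.presheaf.stalk p), 𝔮.IsPrime → Ideal.span (Set.range fun i : Fin n => v i.succ) ≤ 𝔮 →
      v 0 ∉ 𝔮 → 𝔮 = Ideal.span (Set.range fun i : Fin n => v i.succ)) :
    ∃ v' : Fin n → X.presheaf.stalk p',
      (maximalIdeal (X.presheaf.stalk p')).spanFinrank = n ∧ Ideal.span (Set.range v') = maximalIdeal (X.presheaf.stalk p') ∧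
      stalkIdeal C p' = Ideal.span (v' '' ((Finset.univ : Finset (Fin n)) : Set (Fin n))) ∧
      (∀ i, stalkIdeal (Wt i) p' = Ideal.span {v' i}) ∧ p' ∉ K₀.support := by
  classical
  haveI := hreg
  haveI := hreg'
  let φ := (X.presheaf.stalkSpecializes h).hom
  letI := φ.toAlgebra
  set 𝔮₀ : Ideal (X.presheaf.stalk p) := (maximalIdeal (X.presheaf.stalk p')).comap φ with h𝔮₀def
  haveI : IsLocalization.AtPrime (X.presheaf.stalk p') 𝔮₀ := isLocalizationAtPrime_stalkSpecializes h
  have hmapC : stalkIdeal C p' = (Ideal.span (Set.range fun i : Fin n => v i.succ)).map φ := by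
    rw [← stalkIdeal_map_stalkSpecializes C h, hC]
  have hCne : stalkIdeal C p' ≠ ⊤ := (mem_support_iff_stalkIdeal_ne_top C p').mp hp'C
  have hle : Ideal.span (Set.range fun i : Fin n => v i.succ) ≤ 𝔮₀ := by
    rw [Ideal.span_le]
    rintro _ ⟨i, rfl⟩
    rw [h𝔮₀def, SetLike.mem_coe, Ideal.mem_comap]
    refine le_maximalIdeal hCne ?_
    rw [hmapC]
    exact Ideal.mem_map_of_mem _ (Ideal.subset_span ⟨i, rfl⟩)
  have h0 : v 0 ∉ 𝔮₀ := fun hmem => by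
    rw [h𝔮₀def, Ideal.mem_comap] at hmem
    exact (mem_maximalIdeal _).mp hmem hunit
  have h𝔮₀ : 𝔮₀ = Ideal.span (Set.range fun i : Fin n => v i.succ) := hquot 𝔮₀ (Ideal.IsPrime.comap φ) hle h0
  set v' : Fin n → X.presheaf.stalk p' := fun i => φ (v i.succ) with hv'def
  have hv' : Ideal.span (Set.range v') = maximalIdeal (X.presheaf.stalk p') := by
    rw [← IsLocalization.AtPrime.map_eq_maximalIdeal 𝔮₀ (X.presheaf.stalk p'), h𝔮₀, Ideal.map_span, ← Set.range_comp]
    rfl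
  have hsf' : (maximalIdeal (X.presheaf.stalk p')).spanFinrank = n := by
    have h1 := (isRegularLocalRing_iff _).mp hreg'
    rw [IsLocalization.AtPrime.ringKrullDim_eq_height 𝔮₀ (X.presheaf.stalk p'), h𝔮₀] at h1
    have h2 : (Ideal.span (Set.range fun i : Fin n => v i.succ)).height = n :=
      height_span_range_comp_rsop hsf v hv Fin.succ (Fin.succ_injective n)
    rw [h2] at h1
    exact_mod_cast h1
  have hK₀' : stalkIdeal K₀ p' = ⊤ := by
    rw [← stalkIdeal_map_stalkSpecializes K₀ h, hK₀, Ideal.map_span, Set.image_singleton, Ideal.span_singleton_eq_top]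
    exact hunit
  refine ⟨v', hsf', hv', ?_, fun i => ?_, fun hp => (mem_support_iff_stalkIdeal_ne_top K₀ p').mp hp hK₀'⟩
  · rw [hmapC, Ideal.map_span, ← Set.range_comp, Finset.coe_univ, Set.image_univ]
    rfl
  · rw [← stalkIdeal_map_stalkSpecializes (Wt i) h, hWt i, Ideal.map_span, Set.image_singleton]

/-- Part 2's point step, with the point `p = τ y₁` given by an equation (so that data at `p` can be fed in). [cite: Kollar2007, Def. 3.25] -/
theorem sncWithAt_cons_comap_transform_of_eq {X X₁ : Scheme.{0}} [IsLocallyNoetherian X] {τ : X₁ ⟶ X} {C : X.IdealSheafData}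
    (hτ : IsBlowup τ C) (y₁ : X₁) (p : X) (hp : τ y₁ = p) (hpC : p ∈ C.support)
    (hreg : IsRegularLocalRing (X.presheaf.stalk p)) {d : ℕ}
    (hsf : (maximalIdeal (X.presheaf.stalk p)).spanFinrank = d) (u₀ : Fin d → X.presheaf.stalk p)
    (hu₀ : Ideal.span (Set.range u₀) = maximalIdeal (X.presheaf.stalk p)) (S₀ : Finset (Fin d))
    (hS₀ : stalkIdeal C p = Ideal.span (u₀ '' (S₀ : Set (Fin d))))
    (K₀ : X.IdealSheafData) (hK₀ : p ∉ K₀.support ∨ ∃ t₀, t₀ ∉ S₀ ∧ stalkIdeal K₀ p = Ideal.span {u₀ t₀})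
    {m : ℕ} (Wt : Fin m → X.IdealSheafData) (κ : Fin m → Fin d) (hκ : Function.Injective κ) (hκS : ∀ i, κ i ∈ S₀)
    (hWt : ∀ i, stalkIdeal (Wt i) p = Ideal.span {u₀ (κ i)}) :
    DepthSNC.SNCWithAt (K₀.comap τ :: (List.ofFn (fun i => strictTransformIdeal τ C (Wt i)) ++ [C.comap τ])) ⊤ y₁ ∧
      ∀ D ∈ List.ofFn (fun i => strictTransformIdeal τ C (Wt i)) ++ [C.comap τ],
        y₁ ∈ (K₀.comap τ).support → y₁ ∈ D.support → stalkIdeal D y₁ ≠ stalkIdeal (K₀.comap τ) y₁ := by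
  subst hp
  exact sncWithAt_cons_comap_transform hτ y₁ hpC hreg hsf u₀ hu₀ S₀ hS₀ K₀ hK₀ Wt κ hκ hκS hWt

/-! ## §2 (B3a) `sncInv_init` -/

/-- **(B3a) `sncInv_init`** — at K5′'s point step, for every frame `W` at `x`, an upstairs boundary `EX₁` on `X₁ = Bl_{ker s} X'` with
`ND.SNCInv₂ P Y X₁ (τ₁ ≫ σ') F₂ j₂ EX₁ ((frameBoundary W).stepAlong 𝓘_{{x}} 𝟙 υ)`: `EX₁ := (frameBoundary W̃).stepAlong (ker s) 𝟙 τ₁` for the prime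
divisors `W̃_i` of the lifted frame, `R := {𝟙} ∪ range e` (see the module docstring). [cite: Matsumura1987, Thm. 14.2] [cite: Kollar2007, Def. 3.25]
[cite: GortzWedhorn2020, Thm. 11.40 (2)] [OURS · L1 W4.5b · (B3a) of DEAL «ND-K5»; helper toward stmt-ResolutionOfSingularities-20148; NOT a statement
of the manuscript] -/
theorem sncInv_init (k : Type) [Field k] (n : ℕ) :
    (∀ (O : Type) [CommRing O] [IsDomain O] [IsDiscreteValuationRing O] [IsAdicComplete (IsLocalRing.maximalIdeal O) O]
        [IsAlgClosed (IsLocalRing.ResidueField O)] (θ : O →+* k), Function.Surjective θ →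
      ∀ (P : AlgebraicGeometry.Scheme.{0}) (q : P ⟶ AlgebraicGeometry.Spec (.of O)) (Y : Set P)
        (Ch : ∀ X' : AlgebraicGeometry.Scheme.{0}, (X' ⟶ P) → Set X' → Prop),
        (∀ (X' X'' : AlgebraicGeometry.Scheme.{0}) (σ' : X' ⟶ P) (S' : Set X') (C : X'.IdealSheafData) (τ : X'' ⟶ X'),
          Ch X' σ' S' → Literature.AlgebraicGeometry.Resolution.IsBlowup τ C →
          Literature.AlgebraicGeometry.Resolution.Scheme.IsRegular C.subscheme → AlgebraicGeometry.Flat (C.subschemeι ≫ σ' ≫ q) →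
          σ' '' (C.support : Set X') ⊆ {y | ¬ IsGenericPoint y Y} →
          (C.support : Set X') ∩ (σ' ≫ q) ⁻¹' {IsLocalRing.closedPoint O} ⊆ S' →
          Ch X'' (τ ≫ σ') (closure (τ ⁻¹' (S' \ (C.support : Set X'))))) →
        (∀ (X' : AlgebraicGeometry.Scheme.{0}) (σ' : X' ⟶ P) (S' : Set X'), Ch X' σ' S' →
          Summit.ResolutionOfSingularities.ResolutionOfSingularities.Theses.EquisingularLift.Split.Chain P Y X' σ' S') →
        Y ⊆ q ⁻¹' {IsLocalRing.closedPoint O} → IsIrreducible Y → IsClosed Y →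
        AlgebraicGeometry.IsIntegral P → IsLocallyNoetherian P → Literature.AlgebraicGeometry.Resolution.Scheme.IsRegular P →
        AlgebraicGeometry.IsProper q → AlgebraicGeometry.SmoothOfRelativeDimension n q →
      -- the stage before the point step and its model
      ∀ (X' : AlgebraicGeometry.Scheme.{0}) (σ' : X' ⟶ P) (S' : Set X'), Ch X' σ' S' → AlgebraicGeometry.IsIntegral X' →
        IsLocallyNoetherian X' → Literature.AlgebraicGeometry.Resolution.Scheme.IsRegular X' →
        AlgebraicGeometry.IsDominant (σ' ≫ q) →
      ∀ (F₁ : AlgebraicGeometry.Scheme.{0}), AlgebraicGeometry.IsIntegral F₁ → ∀ (j : F₁ ⟶ X')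
        (t : F₁ ⟶ AlgebraicGeometry.Spec (.of k)),
        IsPullback j t (σ' ≫ q) (AlgebraicGeometry.Spec.map (CommRingCat.ofHom θ)) →
      ∀ (T₁ : Set F₁), IsClosed T₁ → IsIrreducible T₁ → j '' T₁ = S' →
      -- the point step: section, its blow-up, the new stage and its model
      ∀ (x : F₁) (hx : IsClosed ({x} : Set F₁)) (U : X'.Opens), AlgebraicGeometry.Smooth (U.ι ≫ σ' ≫ q) →
      ∀ (s : AlgebraicGeometry.Spec (.of O) ⟶ X'), s ≫ σ' ≫ q = 𝟙 _ → s (IsLocalRing.closedPoint O) ∈ U →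
        s (IsLocalRing.closedPoint O) = j x →
        ringKrullDim (X'.presheaf.stalk (s (IsLocalRing.closedPoint O))) = ((n + 1 : ℕ) : WithBot ℕ∞) →
        IsRegularLocalRing (F₁.presheaf.stalk x) →
        (∀ c ∈ (s.ker.support : Set X'), ¬ IsGenericPoint (σ' c) Y) →
      ∀ (X₁ : AlgebraicGeometry.Scheme.{0}) (τ₁ : X₁ ⟶ X'), Literature.AlgebraicGeometry.Resolution.IsBlowup τ₁ s.ker →
        AlgebraicGeometry.IsIntegral X₁ → IsLocallyNoetherian X₁ → Literature.AlgebraicGeometry.Resolution.Scheme.IsRegular X₁ →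
        AlgebraicGeometry.IsDominant ((τ₁ ≫ σ') ≫ q) →
      ∀ (F₂ : AlgebraicGeometry.Scheme.{0}), AlgebraicGeometry.IsIntegral F₂ → ∀ (υ : F₂ ⟶ F₁),
        Literature.AlgebraicGeometry.Resolution.IsBlowup υ
          (AlgebraicGeometry.Scheme.IdealSheafData.vanishingIdeal (⟨{x}, hx⟩ : TopologicalSpace.Closeds F₁)) →
      ∀ (j₂ : F₂ ⟶ X₁) (t₂ : F₂ ⟶ AlgebraicGeometry.Spec (.of k)),
        IsPullback j₂ t₂ ((τ₁ ≫ σ') ≫ q) (AlgebraicGeometry.Spec.map (CommRingCat.ofHom θ)) → j₂ ≫ τ₁ = υ ≫ j →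
        (s.ker.comap τ₁).comap j₂ =
          (AlgebraicGeometry.Scheme.IdealSheafData.vanishingIdeal (⟨{x}, hx⟩ : TopologicalSpace.Closeds F₁)).comap υ →
        IsIrreducible (closure (υ ⁻¹' (T₁ \ {x}))) →
        Ch X₁ (τ₁ ≫ σ') (j₂ '' closure (υ ⁻¹' (T₁ \ {x}))) →
      ∀ (hx' : IsClosed ({x} : Set F₁)) (W : Fin n → F₁.IdealSheafData), IsFrameAt W x →
        ∃ EX₁ : Boundary n X₁, SNCInv₂ (n := n) P Y X₁ (τ₁ ≫ σ') F₂ j₂ EX₁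
          ((frameBoundary W).stepAlong (AlgebraicGeometry.Scheme.IdealSheafData.vanishingIdeal (⟨{x}, hx'⟩ : TopologicalSpace.Closeds F₁)) 1 υ)) := by
  intro O _ _ _ _ _ θ hθ P q Y Ch _hE1 hChain _hYq _hYirr _hYcl _hPint hPnoeth hPreg _hqprop _hqsm X' σ' S' hCh hX'int hX'noeth hX'reg
    _hdom F₁ hF₁int j t hsq T₁ _hT₁cl _hT₁irr _hjT₁ x hx U _hU s hs _hsU hsx htdim hxreg hsoff X₁ τ₁ hτ₁ hX₁int hX₁noeth _hX₁reg _hdom₁ F₂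
    hF₂int υ hυ j₂ t₂ hsq₂ hcomm hcarrier _hT₂irr _hCh₂ hx' W hW
  classical
  -- instances and the objects of part 1
  haveI := hX'int; haveI := hX'noeth; haveI := hF₁int; haveI := hX₁int; haveI := hX₁noeth; haveI := hF₂int; haveI := _hqprop
  haveI : IsProper σ' := (chain_isRegular P Y X' σ' S' (hChain X' σ' S' hCh) hPnoeth hPreg).2.2
  haveI : IsClosedImmersion (Spec.map (CommRingCat.ofHom θ)) := IsClosedImmersion.spec_of_surjective _ hθ
  haveI : IsClosedImmersion j := MorphismProperty.IsStableUnderBaseChange.of_isPullback hsq.flip inferInstance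
  haveI : IsClosedImmersion j₂ := MorphismProperty.IsStableUnderBaseChange.of_isPullback hsq₂.flip inferInstance
  haveI : IsLocallyNoetherian F₁ := LocallyOfFiniteType.isLocallyNoetherian j
  haveI : IsProper τ₁ := hτ₁.isProper
  haveI : IsProper υ := hυ.isProper
  haveI : IsLocallyNoetherian F₂ := LocallyOfFiniteType.isLocallyNoetherian υ
  obtain ⟨ϖ, hϖ⟩ := IsDiscreteValuationRing.exists_irreducible O
  have hϖO : ϖ ∈ maximalIdeal O := by rw [hϖ.maximalIdeal_eq]; exact Ideal.mem_span_singleton_self ϖ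
  have hreg : IsRegularLocalRing (X'.presheaf.stalk (j x)) := hX'reg (j x)
  haveI := hreg
  have hdim : ringKrullDim (X'.presheaf.stalk (j x)) = ((n + 1 : ℕ) : WithBot ℕ∞) := by rw [← hsx]; exact htdim
  obtain ⟨wt, h1, h2, h3, h4, hsf, h6, hdom', hqr, hquot⟩ :=
    exists_frameLift O k θ hθ (σ' ≫ q) s hs j t hsq x hsx hreg hdim W hW ϖ hϖ
  haveI := hdom'
  set ϖg : X'.presheaf.stalk (j x) := (X'.presheaf.Γgerm (j x)).hom ((σ' ≫ q).appTop.hom ((Scheme.ΓSpecIso (.of O)).inv.hom ϖ)) with hϖg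
  set v : Fin (n + 1) → X'.presheaf.stalk (j x) := Fin.cons ϖg wt with hvdef
  have hv0 : v 0 = ϖg := rfl
  have hvs : ∀ i : Fin n, v i.succ = wt i := fun i => by rw [hvdef, Fin.cons_succ]
  -- the kernel of the model at the stepped point, the support of the centre
  have hkerj : stalkIdeal j.ker (j x) = Ideal.span {ϖg} := by
    rw [stalkIdeal_ker_eq_ker_stalkMap j x]
    exact le_antisymm (ker_stalkMap_model_le O k θ hθ (σ' ≫ q) j t hsq x ϖ hϖ)
      ((Ideal.span_singleton_le_iff_mem _).mpr (by
        rw [RingHom.mem_ker]; exact stalkMap_model_varpi θ hθ (σ' ≫ q) j t hsq x ϖ hϖO))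
  obtain ⟨_, -, -, hCsupp⟩ := section_isClosedImmersion_and_isRegular_ker O X' (σ' ≫ q) s hs
  have hkerj₂ : j₂.ker = j.ker.comap τ₁ := by
    rw [ker_eq_comap_ker_of_isPullback hsq₂, ker_eq_comap_ker_of_isPullback hsq, ← Scheme.IdealSheafData.comap_comp, Category.assoc]
  -- the upstairs models: prime divisors with germs `(w̃_i)`
  have hprime : ∀ i, Prime (wt i) := by
    intro i
    have hne : wt i ≠ 0 := by
      intro h0
      have hmem : v i.succ ∈ Ideal.span (v '' (∅ : Set (Fin (n + 1)))) := by
        rw [hvs, h0]; exact Ideal.zero_mem _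
      exact not_mem_span_image_of_not_mem hsf v h6 (S := ∅) (by simp) hmem
    rw [← Ideal.span_singleton_prime hne, ← hvs, ← Set.image_singleton,
      show ({i.succ} : Set (Fin (n + 1))) = ((({i.succ} : Finset (Fin (n + 1))) : Set (Fin (n + 1)))) by simp]
    exact isPrime_span_image hsf v h6 _
  choose Wt _hWtpr hWt using fun i => exists_primeDivisorIdeal_stalkIdeal_eq_span hX'reg (j x) (hprime i)
  -- the downstairs images of the lifted frame
  have hc𝔪 : Ideal.span (Set.range fun i => (j.stalkMap x).hom (wt i)) = maximalIdeal (F₁.presheaf.stalk x) :=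
    span_stalkMap_eq_maximalIdeal_of_model θ hθ (σ' ≫ q) j t hsq x ϖ hϖO wt h2
  have hJ : s.ker.comap j = vanishingIdeal ⟨{x}, hx⟩ :=
    comap_ker_eq_vanishingIdeal_of_model θ hθ (σ' ≫ q) s hs j t hsq x hx hsx wt h1 hc𝔪
  have hcbar : IsQuasiRegular (fun i => (j.stalkMap x).hom (wt i)) :=
    isQuasiRegular_stalkMap_model O k θ hθ (σ' ≫ q) j t hsq x wt hqr ϖ hϖ h3
  have hrange : (Set.range fun i : Fin n => v i.succ) = Set.range wt := by
    simp only [hvs]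
  have hCv : stalkIdeal s.ker (j x) = Ideal.span (Set.range fun i : Fin n => v i.succ) := by
    rw [hrange, h1]
  have hquotv : ∀ 𝔮 : Ideal (X'.presheaf.stalk (j x)), 𝔮.IsPrime → Ideal.span (Set.range fun i : Fin n => v i.succ) ≤ 𝔮 →
      v 0 ∉ 𝔮 → 𝔮 = Ideal.span (Set.range fun i : Fin n => v i.succ) := by
    rw [hrange, hv0]
    exact hquot
  -- the model list at a point over the section, and its SNC + guard (parts 1 and 2)
  have main : ∀ y : X₁, τ₁ y ∈ (s.ker.support : Set X') →
      DepthSNC.SNCWithAt (j.ker.comap τ₁ :: (List.ofFn (fun i => strictTransformIdeal τ₁ s.ker (Wt i)) ++ [s.ker.comap τ₁])) ⊤ y ∧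
      ∀ D ∈ List.ofFn (fun i => strictTransformIdeal τ₁ s.ker (Wt i)) ++ [s.ker.comap τ₁],
        y ∈ (j.ker.comap τ₁).support → y ∈ D.support → stalkIdeal D y ≠ stalkIdeal (j.ker.comap τ₁) y := by
    intro y hy
    rw [hCsupp] at hy
    obtain ⟨z, hz⟩ := hy
    rcases eq_closedPoint_or_asIdeal_eq_bot O z with hzc | hz0
    · -- over the closed point of the section: the r.s.p. `(ϖ, w̃)`
      have hp : τ₁ y = j x := by rw [← hz, hzc, hsx]
      have hpC : j x ∈ (s.ker.support : Set X') := by rw [hCsupp, ← hsx]; exact ⟨_, rfl⟩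
      refine sncWithAt_cons_comap_transform_of_eq hτ₁ y (j x) hp hpC hreg hsf v h6 (Finset.univ.image Fin.succ) ?_ j.ker
        (Or.inr ⟨0, by simp, hkerj⟩) Wt Fin.succ (Fin.succ_injective n) (fun i => by simp) (fun i => by rw [hvs]; exact hWt i)
      rw [hCv, Finset.coe_image, Finset.coe_univ, Set.image_univ, ← Set.range_comp]
      rfl
    · -- over the generic point of the section: the r.s.p. `w̃` of `𝒪_{X',s(η)}`
      have hzne : z ≠ closedPoint O := fun h => by
        have : (closedPoint O).asIdeal = ⊥ := h ▸ hz0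
        exact (hϖ.ne_zero) (by
          have hmem : ϖ ∈ (closedPoint O).asIdeal := hϖO
          rw [this] at hmem; exact hmem)
      have hsp : s z ⤳ j x := by rw [← hsx]; exact (IsLocalRing.specializes_closedPoint z).map s.continuous
      have hpC : s z ∈ (s.ker.support : Set X') := by rw [hCsupp]; exact ⟨_, rfl⟩
      have hunit : IsUnit ((X'.presheaf.stalkSpecializes hsp).hom (v 0)) := by
        rw [hv0, hϖg, TopCat.Presheaf.Γgerm, TopCat.Presheaf.germ_stalkSpecializes_apply]
        rw [← isUnit_map_iff (s.stalkMap z).hom]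
        have h := stalkMap_section_Γgerm_appTop O (σ' ≫ q) s hs z ((Scheme.ΓSpecIso (.of O)).inv.hom ϖ)
        rw [TopCat.Presheaf.Γgerm, TopCat.Presheaf.Γgerm] at h
        rw [h]
        exact isUnit_germ_of_ne_closedPoint O z hzne hϖ.ne_zero
      obtain ⟨v', hsf', hv', hC', hWt', hK₀'⟩ := exists_rsop_genericSection hreg v hsf h6 j.ker hkerj Wt
        (fun i => by rw [hvs]; exact hWt i) s.ker hCv hsp (hX'reg (s z)) hpC hunit hquotv
      exact sncWithAt_cons_comap_transform_of_eq hτ₁ y (s z) hz.symm hpC (hX'reg (s z)) hsf' v' hv' Finset.univ hC' j.ker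
        (Or.inl hK₀') Wt id Function.injective_id (fun i => Finset.mem_univ _) hWt'
  -- the present members belong to the model list
  have htail : ∀ D ∈ (insert 1 (Finset.univ.image (e n)) : Finset (Ray n)).toList.map
      (fun ρ => (frameBoundary Wt).stepAlong s.ker 1 τ₁ ρ),
      D ∈ List.ofFn (fun i => strictTransformIdeal τ₁ s.ker (Wt i)) ++ [s.ker.comap τ₁] := by
    intro D hD
    obtain ⟨ρ, hρ, rfl⟩ := List.mem_map.mp hD
    rw [Finset.mem_toList] at hρ
    by_cases hρ1 : ρ = 1
    · subst hρ1
      rw [stepAlong_self]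
      exact List.mem_append_right _ (List.mem_singleton_self _)
    · rcases Finset.mem_insert.mp hρ with h | h
      · exact absurd h hρ1
      · obtain ⟨i, -, rfl⟩ := Finset.mem_image.mp h
        rw [stepAlong_of_ne _ _ hρ1, frameBoundary_e]
        exact List.mem_append_left _ (List.mem_ofFn.mpr ⟨i, rfl⟩)
  -- the boundary and the present rays
  refine ⟨(frameBoundary Wt).stepAlong s.ker 1 τ₁, inferInstance, insert 1 (Finset.univ.image (e n)), ?_, ?_, ?_, ?_, ?_, ?_⟩
  · -- (a) absent rays
    intro ρ hρ
    rw [Finset.mem_insert, not_or, Finset.mem_image] at hρ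
    have hρ1 : ρ ≠ 1 := hρ.1
    have hρe : ρ ∉ Set.range (e n) := by
      rintro ⟨i, rfl⟩; exact hρ.2 ⟨i, Finset.mem_univ _, rfl⟩
    exact ⟨stepAlong_eq_top _ _ hρ1 τ₁ (frameBoundary_of_not_mem_range Wt hρe),
      stepAlong_eq_top _ _ hρ1 υ (frameBoundary_of_not_mem_range W hρe)⟩
  · -- (b) the exceptional divisor lies off the generic point of `Y`
    intro ρ hρ hρe
    have hρ1 : ρ = 1 := by
      rcases Finset.mem_insert.mp hρ with h | h
      · exact h
      · obtain ⟨i, -, rfl⟩ := Finset.mem_image.mp h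
        exact absurd ⟨i, rfl⟩ hρe
    subst hρ1
    rw [stepAlong_self, Scheme.IdealSheafData.support_comap]
    rintro _ ⟨y, hy, rfl⟩
    rw [Scheme.Hom.comp_apply]
    exact hsoff (τ₁ y) hy
  · -- (c) SNC at the points of the exceptional divisor
    rintro y ⟨ρ, hρ, hρe, hy⟩
    have hρ1 : ρ = 1 := by
      rcases Finset.mem_insert.mp hρ with h | h
      · exact h
      · obtain ⟨i, -, rfl⟩ := Finset.mem_image.mp h
        exact absurd ⟨i, rfl⟩ hρe
    subst hρ1
    rw [stepAlong_self, Scheme.IdealSheafData.support_comap] at hy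
    refine (main y hy).1.anti fun D hD hyD => ?_
    rcases List.mem_cons.mp hD with hD | hD
    · rw [hD, hkerj₂]; exact List.mem_cons_self
    · exact List.mem_cons_of_mem _ (htail D hD)
  · -- (c′) the fibre guard there
    rintro ρ hρ y ⟨ρ', hρ', hρ'e, hy⟩ hyj hyρ
    have hρ1 : ρ' = 1 := by
      rcases Finset.mem_insert.mp hρ' with h | h
      · exact h
      · obtain ⟨i, -, rfl⟩ := Finset.mem_image.mp h
        exact absurd ⟨i, rfl⟩ hρ'e
    subst hρ1
    rw [stepAlong_self, Scheme.IdealSheafData.support_comap] at hy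
    rw [hkerj₂] at hyj ⊢
    exact (main y hy).2 _ (htail _ (List.mem_map.mpr ⟨ρ, Finset.mem_toList.mpr hρ, rfl⟩)) hyj hyρ
  · -- (d) the exceptional ray: the carrier identity
    intro ρ hρ hρe
    have hρ1 : ρ = 1 := by
      rcases Finset.mem_insert.mp hρ with h | h
      · exact h
      · obtain ⟨i, -, rfl⟩ := Finset.mem_image.mp h
        exact absurd ⟨i, rfl⟩ hρe
    subst hρ1
    rw [stepAlong_self, stepAlong_self]
    exact hcarrier
  · -- (d) the frame rays on stalks over `x`
    rintro i y ⟨ρ, hρ, hρe, hy⟩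
    have hρ1 : ρ = 1 := by
      rcases Finset.mem_insert.mp hρ with h | h
      · exact h
      · obtain ⟨i, -, rfl⟩ := Finset.mem_image.mp h
        exact absurd ⟨i, rfl⟩ hρe
    subst hρ1
    rw [stepAlong_self, Scheme.IdealSheafData.support_comap] at hy
    have hyx : υ y = x := by
      have h' : υ y ∈ ((vanishingIdeal (⟨{x}, hx'⟩ : Closeds F₁)).support : Set F₁) := hy
      rw [Literature.AlgebraicGeometry.Resolution.coe_support_vanishingIdeal_singleton hx'] at h'
      exact h'
    by_cases hi : e n i = 1
    · rw [hi, stepAlong_self, stepAlong_self, hcarrier]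
    · rw [stepAlong_of_ne _ _ hi, stepAlong_of_ne _ _ hi, frameBoundary_e, frameBoundary_e]
      have hΦ : MvPolynomial.map (Ideal.Quotient.mk (Ideal.span (Set.range wt))) (MvPolynomial.X i : MvPolynomial (Fin n) _) ≠ 0 := by
        rw [MvPolynomial.map_X]; exact MvPolynomial.X_ne_zero i
      haveI : Nontrivial (F₁.presheaf.stalk x ⧸ Ideal.span (Set.range fun i => (j.stalkMap x).hom (wt i))) := by
        rw [hc𝔪]; exact Ideal.Quotient.nontrivial_iff.mpr (maximalIdeal.isMaximal _).ne_top
      have hΦbar : MvPolynomial.map (Ideal.Quotient.mk (Ideal.span (Set.range fun i => (j.stalkMap x).hom (wt i))))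
          (MvPolynomial.map (j.stalkMap x).hom (MvPolynomial.X i : MvPolynomial (Fin n) _)) ≠ 0 := by
        rw [MvPolynomial.map_X, MvPolynomial.map_X]; exact MvPolynomial.X_ne_zero i
      have hK : stalkIdeal (Wt i) (j x) = Ideal.span {MvPolynomial.eval wt (MvPolynomial.X i)} := by
        rw [MvPolynomial.eval_X]; exact hWt i
      have hglob := comap_strictTransformIdeal_eq_of_model τ₁ s.ker (Wt i) hτ₁ j υ j₂ hcomm x hx hυ hJ wt h1 hqr
        (MvPolynomial.X i) (MvPolynomial.isHomogeneous_X _ i) hΦ hK hcbar hΦbar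
      rw [hglob]
      refine stalkIdeal_strictTransformIdeal_congr (π := υ) (C := vanishingIdeal ⟨{x}, hx⟩) ?_
      rw [hyx, stalkIdeal_comap_eq_map_stalkMap, hWt i, Ideal.map_span, Set.image_singleton, h4 i]

end Summit.ResolutionOfSingularities.ResolutionOfSingularities.Cruxes.EquisingularLiftNat.Sections.ND

end
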